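import Literature.AlgebraicGeometry.Motives.AbelianVarietyWeilPairingAlternating
import Literature.AlgebraicGeometry.Motives.CartierDivisorClassPullback
import HarnessLib

/-!
# The level Weil pairing depends only on the divisor CLASS, additively:
# `ē^{Θ}` for `Θ ∼ Θ'`, `ē^{Θ + Θ'} = ē^Θ ē^{Θ'}`, `ē^{n • Θ} = (ē^Θ)ⁿ` (Lang VII §2; Mumford §20)

Layer `Literature/AlgebraicGeometry/Motives`, namespace `Literature.AlgebraicGeometry.Motives.AbelianVariety`.
KERNEL ONLY: theorems; no definition, no named fact, no `sorry`.

For an abelian variety `A` over a field `K`, a level `N` with `[N]_A` dominant and `P, Q ∈ A[N](K)`, the level-`N`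
Weil pairing `ē_N^Θ(P, Q) = e_N(P, D_Q(Θ))`, `D_Q(Θ) = t_Q^* Θ − Θ`, of the tree
(`Motives/AbelianVarietyWeilPairingLevel`) satisfies

* `weilPairingLevel_congr_sameDivisor` / **`weilPairingLevel_congr_linEquiv`** — `ē_N^Θ = ē_N^{Θ'}` for
  `Θ ∼ Θ'` (the pairing is attached to the class of `Θ`, i.e. to the line bundle / polarisation `φ_Θ`:
  `D_Q(Θ) ∼ D_Q(Θ')` and Lang VII §2 Prop. 3 «`e_n(a, X)` depends only on the class of `X`»,
  the tree's `kummerConst_eq_of_linEquiv`);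
* **`weilPairingLevel_add`** — `ē_N^{Θ + Θ'}(P, Q) = ē_N^Θ(P, Q) ē_N^{Θ'}(P, Q)` (`D_Q(Θ + Θ') = D_Q(Θ) + D_Q(Θ')`
  and bilinearity of the Kummer pairing in the divisor, `kummerConst_add`; Lang VII §2 after Prop. 3:
  «`(a, ξ) ↦ e_n(a, ξ)` is a bilinear map»; Mumford §20: `e^{L₁ ⊗ L₂} = e^{L₁} e^{L₂}` via `φ_{L₁⊗L₂} = φ_{L₁} + φ_{L₂}`);
* `weilPairingLevel_zero`, **`weilPairingLevel_smul`** — `ē_N^0 = 1`, `ē_N^{n • Θ} = (ē_N^Θ)ⁿ`.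

Divisor algebra used (all in the tree): `CartierDivisor.neg_add_rev_sameDivisor` (`−(D + E) = −D + −E`),
`add_add_add_comm_sameDivisor`, `zero_smul_sameDivisor`, `pullback_add_sameDivisor`, `add_smul_sameDivisor`,
`SameDivisor.add/neg/pullback`, `LinEquiv.add/neg/pullback`.

Use (cell `hodgecm-mathlib`, row II-1 v2, stub S5 in ℓ-adic form, B-p20 PREP-II1-S5): the reduction step
«`(κ^{-1}X^σ)~ = p X̃`» is an identity of divisor CLASSES, consumed as `ē^{κ^*X^σ} = ē^{pX} = (ē^X)^p`.

## References
* [Lang1983AbelianVarieties] S. Lang, *Abelian Varieties*, Ch. VII §2, Prop. 3 and the remark after it (PDF p. 139).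
* [MumfordAV1970] D. Mumford, *Abelian Varieties* (1970), §20, pp. 183–186 (`e^L` and `φ_L`).
-/

universe u

open CategoryTheory CategoryTheory.Limits AlgebraicGeometry MonoidalCategory CartesianMonoidalCategory

noncomputable section

namespace Literature.AlgebraicGeometry.Motives

open scoped MonObj
open RatFn

namespace AbelianVariety

variable {K : Type u} [Field K] (A : AbelianVariety K)

/-! ### `D_Q(Θ)` as a function of the class of `Θ` -/

/-- `D_Q(Θ)` and `D_Q(Θ')` are the same divisor when `Θ`, `Θ'` are. [cite: MumfordAV1970, §8 (definition of φ_L)] -/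
theorem weilDiv_congr_sameDivisor {Θ Θ' : CartierDivisor A.X.left} (h : Θ.SameDivisor Θ') (Q : A.Points K) :
    (A.weilDiv Θ Q).SameDivisor (A.weilDiv Θ' Q) :=
  (h.pullback _).add h.neg

/-- **`D_Q(Θ) ∼ D_Q(Θ')` for `Θ ∼ Θ'`** (`φ_Θ` depends only on the class of `Θ`). [cite: MumfordAV1970, §8 (definition of φ_L)] -/
theorem weilDiv_congr_linEquiv {Θ Θ' : CartierDivisor A.X.left} (h : Θ.LinEquiv Θ') (Q : A.Points K) :
    (A.weilDiv Θ Q).LinEquiv (A.weilDiv Θ' Q) :=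
  (h.pullback _).add h.neg

/-- **`D_Q(Θ + Θ') = D_Q(Θ) + D_Q(Θ')`** as divisors (`φ_{L ⊗ L'} = φ_L + φ_{L'}`). [cite: MumfordAV1970, §8 (definition of φ_L)] -/
theorem weilDiv_add_sameDivisor (Θ Θ' : CartierDivisor A.X.left) (Q : A.Points K) :
    (A.weilDiv (Θ + Θ') Q).SameDivisor (A.weilDiv Θ Q + A.weilDiv Θ' Q) :=
  ((CartierDivisor.pullback_add_sameDivisor Θ Θ' _).add (CartierDivisor.neg_add_rev_sameDivisor Θ Θ')).trans
    (CartierDivisor.add_add_add_comm_sameDivisor _ _ _ _)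

/-- `D_Q(0)` is the zero divisor (same divisor). [cite: MumfordAV1970, §8 (definition of φ_L)] -/
theorem weilDiv_zero_sameDivisor (Q : A.Points K) : (A.weilDiv 0 Q).SameDivisor 0 := fun p j x _ _ => by
  change IsUnitAt x (functionFieldMap (A.translation Q).left 1 * (1 : A.X.left.functionField)⁻¹ / 1)
  rw [map_one, inv_one, mul_one, div_one]
  exact isUnitAt_one

/-! ### The pairing on divisor classes -/

section Level

variable {A} {N : ℕ} [IsDominant (Hom.toSchemeHom ((N : ℤ) • 𝟙 A))]

/-- `ē_N^Θ = ē_N^{Θ'}` for two presentations of the same divisor. [cite: Lang1983AbelianVarieties, Ch. VII §2 Prop. 3] -/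
theorem weilPairingLevel_congr_sameDivisor {Θ Θ' : CartierDivisor A.X.left} (h : Θ.SameDivisor Θ')
    (P Q : A.torsionPoints K N) : A.weilPairingLevel Θ P Q = A.weilPairingLevel Θ' P Q := by
  rw [weilPairingLevel_eq_kummerConst (Q := Q)
    ((A.isTrivializer_weilFn Θ' Q).of_sameDivisor (A.weilDiv_congr_sameDivisor h Q.1).symm) P]
  rfl

/-- **`ē_N^Θ = ē_N^{Θ'}` for linearly equivalent `Θ ∼ Θ'`**: the Weil pairing is attached to the divisor
class (Lang VII §2 Prop. 3: `e_n(a, X)` depends only on the linear equivalence class; here for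
`D_Q(Θ) ∼ D_Q(Θ')`). [cite: Lang1983AbelianVarieties, Ch. VII §2 Prop. 3] -/
theorem weilPairingLevel_congr_linEquiv {Θ Θ' : CartierDivisor A.X.left} (h : Θ.LinEquiv Θ')
    (P Q : A.torsionPoints K N) : A.weilPairingLevel Θ P Q = A.weilPairingLevel Θ' P Q := by
  rw [weilPairingLevel_eq_kummerConst_of_linEquiv (A.isTrivializer_weilFn Θ' Q) (A.weilDiv_congr_linEquiv h Q.1) P]
  rfl

/-- **`ē_N^{Θ + Θ'}(P, Q) = ē_N^Θ(P, Q) · ē_N^{Θ'}(P, Q)`** — bilinearity of `e_N` in the divisor (Lang VII §2,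
remark after Prop. 3) applied to `D_Q(Θ + Θ') = D_Q(Θ) + D_Q(Θ')`. [cite: Lang1983AbelianVarieties, Ch. VII §2 Prop. 3] -/
theorem weilPairingLevel_add (Θ Θ' : CartierDivisor A.X.left) (P Q : A.torsionPoints K N) :
    A.weilPairingLevel (Θ + Θ') P Q = A.weilPairingLevel Θ P Q * A.weilPairingLevel Θ' P Q := by
  have hh := (A.isTrivializer_weilFn Θ Q).add (A.isTrivializer_weilFn Θ' Q)
  rw [weilPairingLevel_eq_kummerConst (Q := Q) (hh.of_sameDivisor (A.weilDiv_add_sameDivisor Θ Θ' Q.1).symm) P]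
  exact kummerConst_add (A.isTrivializer_weilFn Θ Q) (A.isTrivializer_weilFn Θ' Q) P

/-- `ē_N^0 = 1`. [cite: Lang1983AbelianVarieties, Ch. VII §2 Prop. 3] -/
theorem weilPairingLevel_zero (P Q : A.torsionPoints K N) :
    A.weilPairingLevel (0 : CartierDivisor A.X.left) P Q = 1 := by
  rw [weilPairingLevel_eq_kummerConst (Q := Q)
    ((A.isTrivializer_zero (N := N)).of_sameDivisor (A.weilDiv_zero_sameDivisor Q.1).symm) P]
  exact kummerConst_zero P

/-- **`ē_N^{n • Θ} = (ē_N^Θ)ⁿ`** (`φ_{L^{⊗n}} = n φ_L`; in the application `ē^{pX} = (ē^X)^p`).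
[cite: Lang1983AbelianVarieties, Ch. VII §2 Prop. 3] -/
theorem weilPairingLevel_smul (Θ : CartierDivisor A.X.left) (n : ℕ) (P Q : A.torsionPoints K N) :
    A.weilPairingLevel (n • Θ) P Q = A.weilPairingLevel Θ P Q ^ n := by
  induction n with
  | zero =>
    rw [pow_zero, weilPairingLevel_congr_sameDivisor (CartierDivisor.zero_smul_sameDivisor Θ)]
    exact weilPairingLevel_zero P Q
  | succ n ih =>
    rw [weilPairingLevel_congr_sameDivisor (CartierDivisor.add_smul_sameDivisor Θ n 1), weilPairingLevel_add, ih,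
      CartierDivisor.one_smul, pow_succ]

end Level

end AbelianVariety

end Literature.AlgebraicGeometry.Motives

end
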